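import Literature.NumberTheory.Automorphic.Liu2021.Def411WeilCarriersIrreducibleOrZeroAtLine
import Literature.NumberTheory.Rogawski1990.CurveThetaHodgeTypeNecessity
import Mathlib.RepresentationTheory.Intertwining
import HarnessLib

/-!
# LD2 organ L₂, step (i): two θ-type labels of ONE irreducible `σ` give EQUIVALENT non-zero carriers; hence
# «line-class rigidity at a fixed label» follows from the print-shaped statement «equivalent non-zero carriers have equal collections»

Cell `hodgecm-mathlib`, half A line LD2 (socket 27458 `stub_S1b_facts` = books #74 E3nec-hol, [Liu2021, Rem. D.5 ⇒]; in-house residue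
G2 = ★ `F0P5CurveThetaLettersPaydown.PinnedHolNecessity₂`), organ U₂∕L₂ of LD2-plan's ORGAN PLAN v0 (2026-09-02), seat LD2-p01 (g0).
THEOREMS ONLY (no `def`, no `sorry`, no instance, no notation); `--supports stmt-HodgeConjecture-24832`.

WHAT.  In G2's tokens (`L` CM, real diagonal frame `dV` of `H` through `g` with `formCongr c g (t • H) = diagonal dV`, reindexing `e₁`,
conjugate-symplectic label `λ`, the carrier `ω(λ, ε_a, χ)_f = rhoVAtLine … (toHeckeCharacter L λ) … a χ` of `U(diag dV)(𝔸_{L⁺,f})`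
transported to `U(H)(𝔸_{L⁺,f})` along `(finAdelicCongr … g ht hg).symm`):
* §1 (generic, [Liu2021, Def. 4.11 «irreducible» read as irreducible-or-zero, ★ `IsIrreducibleOrZero`]): an INJECTIVE intertwiner from a
  representation on a non-zero space into an irreducible-or-zero one is onto, hence an equivalence (`nonempty_equiv_of_injective_of_isIrreducibleOrZero`).
* §2 `exists_linearEquiv_rhoVAtLine_of_injective_pair`: if an IRREDUCIBLE `σ` of `U(H)(𝔸_f)` embeds (G2's `j`) in `ω(λ, ε_a, χ)_f ∘ congr⁻¹` AND
  (a second `j′`) in `ω(λ, ε_{a′}, χ′)_f ∘ congr⁻¹`, then `ω(λ, ε_a, χ)_f` is NON-ZERO and there is a `U(diag dV)(𝔸_f)`-equivariant linear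
  equivalence `ω(λ, ε_a, χ)_f ≃ ω(λ, ε_{a′}, χ′)_f` — both carriers are irreducible or zero UNCONDITIONALLY (★
  `isIrreducibleOrZero_rhoVAtLine_chiSplittingLine_comp_of_surjective`, every rank `n ≥ 2`, [MVW IV.4] ★ + [Zelevinsky1980] ★), so `j`, `j′` are onto.
* §3 `lineClassRigidity₂_of_equivForces`: HENCE the organ L₂ «`σ ↪ ω(λ,ε_a,χ)_f ∘ congr⁻¹ ∧ σ ↪ ω(λ,ε_{a′},χ′)_f ∘ congr⁻¹ ⇒
  ∀ v, locF a v = locF a′ v`» follows from the PRINT-SHAPED statement E₂ «an equivalence of NON-ZERO carriers `ω(λ,ε_a,χ)_f ≃ ω(λ,ε_{a′},χ′)_f`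
  at one `λ` forces equal collections» = [Liu2021, Thm. 4.18 (2)]'s `ε`-component («the modules `ω(μ, ε, χ)` are mutually non-isomorphic»;
  proof l. 2270 «Statement (2) follows from Lemma D.1») — the rank-2 twin of the ★ PROVED rank-`≥ 3` theorem
  `Def411WeilCarriersTripleSeparation.locF_eq_of_equiv_of_lemD1AsPrintedAtV`, displayed here as the hypothesis `hE` (its in-house proof =
  ★ `nonempty_equiv_localTypes_of_equivId_of_isIrreducible` (rank-free but for `NeZero n`) + [Lem. D.1 (4)] same-`λ` at non-split places +
  ★ `locF_eq_of_forall_sameClass_epsLine`; step (ii), separate file).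

HONEST LABEL.  HC_CM is proved only modulo the 7 printed citations (2 remaining: hLiu418 = stmt-HodgeConjecture-24832, h413 =
stmt-HodgeConjecture-24833) until rung 0 closes; this file discharges none of them.

## References
* [Liu2021] Y. Liu, *Fourier–Jacobi cycles and arithmetic relative trace formula*, Camb. J. Math. 9 (2021) = arXiv:2102.11518: Def. 4.11 (p. 46),
  Thm. 4.18 (2) (p. 47) and its proof (p. 48, «Statement (2) follows from Lemma D.1»), App. D Lem. D.1 (1), (4) (pp. 125–126), proof of Prop. D.4 (1) (p. 131).
* [FlathCorvallis1979] D. Flath, *Decomposition of representations into tensor products*, PSPM 33.1 (1979), Thm. 3.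
-/

set_option autoImplicit false
set_option linter.dupNamespace false

noncomputable section

open NumberField NumberField.InfinitePlace MeasureTheory IsDedekindDomain
open scoped Matrix ComplexOrder
open Literature.NumberTheory.Automorphic Literature.NumberTheory.Automorphic.UnitaryGroup
open Literature.NumberTheory.Automorphic.UnitaryCurveForms
open Literature.NumberTheory.Automorphic.Liu2021 Literature.NumberTheory.Automorphic.Liu2021.Def411WeilCarriers
open Literature.NumberTheory.Automorphic.Liu2021.Def411WeilCarriersDoubling
open Literature.NumberTheory.GaloisRepresentations Literature.NumberTheory.Automorphic.IdeleClassGroup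
open Literature.NumberTheory.GelbartRogawski1991 Literature.NumberTheory.GelbartRogawski1991.UnitaryDualPair
open Literature.NumberTheory.GelbartRogawski1991.UnitaryDualPair.WeilCoinv
open Literature.RepresentationTheory.Liu2021 Literature.RepresentationTheory.HarrisKudlaSweet1996

namespace Summit.HodgeConjecture.HodgeConjecture.Cruxes.HLiu418.F0LD2LineClassOfEquiv

/-! ## §1 Generic: an injective intertwiner into an irreducible-or-zero representation is an equivalence -/

section Generic

variable {G V W : Type} [Group G] [AddCommGroup V] [Module ℂ V] [AddCommGroup W] [Module ℂ W]
  {ρ : Representation ℂ G V} {τ : Representation ℂ G W}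

/-- An injective intertwiner from a representation on a NON-ZERO space into an irreducible-or-zero representation is onto
(its range is a non-zero subrepresentation). [cite: Liu2021, Def. 4.11 (l. 2096) «irreducible»; Lem. D.1 (l. 5227)] -/
theorem surjective_of_injective_of_isIrreducibleOrZero [Nontrivial V] (hτ : IsIrreducibleOrZero τ)
    (j : ρ.IntertwiningMap τ) (hj : Function.Injective j) : Function.Surjective j := by
  rcases hτ j.range with h | h
  · exfalso
    obtain ⟨v, hv⟩ := exists_ne (0 : V)
    have hmem : j v ∈ (j.range).toSubmodule := LinearMap.mem_range_self j.toLinearMap v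
    rw [h] at hmem
    change j v ∈ (⊥ : Submodule ℂ W) at hmem
    rw [Submodule.mem_bot] at hmem
    exact hv (hj (hmem.trans (map_zero j).symm))
  · intro w
    have hw : w ∈ (j.range).toSubmodule := by
      rw [h]
      exact Submodule.mem_top
    obtain ⟨v, hv⟩ := LinearMap.mem_range.1 hw
    exact ⟨v, hv⟩

/-- … hence it is an EQUIVALENCE of representations. [cite: Liu2021, Def. 4.11 (l. 2096); Lem. D.1 (l. 5227)] -/
theorem nonempty_equiv_of_injective_of_isIrreducibleOrZero [Nontrivial V] (hτ : IsIrreducibleOrZero τ)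
    (j : ρ.IntertwiningMap τ) (hj : Function.Injective j) : Nonempty (ρ.Equiv τ) :=
  ⟨Representation.Equiv.mk (LinearEquiv.ofBijective j.toLinearMap ⟨hj, surjective_of_injective_of_isIrreducibleOrZero hτ j hj⟩)
    fun g => LinearMap.ext fun v => by
      simp only [LinearMap.coe_comp, LinearEquiv.coe_coe, Function.comp_apply, LinearEquiv.ofBijective_apply]
      exact j.isIntertwining _ _ g v⟩

/-- A `Representation.Equiv` moves non-triviality of the space. [folklore] -/
theorem nontrivial_of_equiv [Nontrivial V] (e : ρ.Equiv τ) : Nontrivial W :=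
  e.toLinearEquiv.toEquiv.symm.nontrivial

end Generic

/-! ## §2 Two θ-type labels of one irreducible `σ` ⇒ equivalent non-zero carriers -/

section Carriers

variable (L : Type) [Field L] [NumberField L] [IsCMField L] (H : Matrix (Fin 2) (Fin 2) L)
  (dV : Fin 2 → L) (hdV : ∀ i, IsCMField.complexConj L (dV i) = dV i) (hdV0 : ∀ i, dV i ≠ 0)
  (t : L) (ht : t ≠ 0) (g : GL (Fin 2) L)
  (hg : formCongr ((IsCMField.complexConj L : L ≃ₐ[↥(maximalRealSubfield L)] L) : L →+* L) g (t • H) = Matrix.diagonal dV)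
  {n' : ℕ} (e₁ : Fin 2 × Fin 1 ≃ Fin n')
  (lam : Literature.NumberTheory.Automorphic.IdeleClassGroup L →ₜ* Circle) (hlam : IsConjugateSymplectic L lam)
  (a a' : (↥(maximalRealSubfield L))ˣ) (χ χ' : Chi (↥(maximalRealSubfield L)) L (IsCMField.complexConj L))
  {W : Type} [AddCommGroup W] [Module ℂ W]
  (σ : Representation ℂ (finAdelic (↥(maximalRealSubfield L)) L (IsCMField.complexConj L) 2 H) W)

set_option maxHeartbeats 800000 in -- measured (400 k, 800 k]: the two CM θ-package carriers (`rhoVAtLine … (fun a => isCompatible_chiSplittingLine …) …`) under `whnf`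
/-- **Two θ-type labels of one irreducible `σ` give EQUIVALENT NON-ZERO carriers.**  If `σ` (irreducible) embeds in
`ω(λ, ε_a, χ)_f ∘ congr⁻¹` (G2's `j`) and in `ω(λ, ε_{a′}, χ′)_f ∘ congr⁻¹` (`j′`), then `ω(λ, ε_a, χ)_f` is non-zero and there is a
`U(diag dV)(𝔸_{L⁺,f})`-equivariant linear equivalence `ω(λ, ε_a, χ)_f ≃ ω(λ, ε_{a′}, χ′)_f` (★ irreducible-or-zero carriers ⇒ `j`, `j′` onto;
transport through the group isomorphism `finAdelicCongr … g ht hg`).  Output = the `hst` shape of ★ `locF_eq_of_equiv_of_lemD1AsPrintedAtV`.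
[cite: Liu2021, Def. 4.11 (l. 2090–2096); App. D Lem. D.1 (l. 5227); proof of Prop. D.4 (1) p. 131 L1–2] -/
theorem exists_linearEquiv_rhoVAtLine_of_injective_pair (hirr : σ.IsIrreducible)
    (j : σ.IntertwiningMap
        ((rhoVAtLine (↥(maximalRealSubfield L)) L (IsCMField.complexConj L) 2 e₁ (Matrix.diagonal dV)
            (complexConj_imagUnit L) (imagUnit_ne_zero L) (imagUnit_mul_self L) (realDiagonal_isSymm L dV hdV)
            (isUnit_det_realDiagonal L dV hdV hdV0) (realDiagonal_map L dV hdV).symm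
            (fun a => isCompatible_chiSplittingLine L e₁ dV hdV hdV0 (toHeckeCharacter L lam)
              (isUnitary_toHeckeCharacter L lam) ((isOscillatorChar_toHeckeCharacter_iff lam).mpr hlam)
              (TW (↥(maximalRealSubfield L)) a) (isSymm_TW (↥(maximalRealSubfield L)) a)
              (isUnit_det_TW (↥(maximalRealSubfield L)) a) (JW (↥(maximalRealSubfield L)) L a)
              (JW_eq (↥(maximalRealSubfield L)) L a)) a χ).comp
          (finAdelicCongr (↥(maximalRealSubfield L)) L (IsCMField.complexConj L) g ht hg).symm.toMonoidHom))
    (hj : Function.Injective j)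
    (j' : σ.IntertwiningMap
        ((rhoVAtLine (↥(maximalRealSubfield L)) L (IsCMField.complexConj L) 2 e₁ (Matrix.diagonal dV)
            (complexConj_imagUnit L) (imagUnit_ne_zero L) (imagUnit_mul_self L) (realDiagonal_isSymm L dV hdV)
            (isUnit_det_realDiagonal L dV hdV hdV0) (realDiagonal_map L dV hdV).symm
            (fun a => isCompatible_chiSplittingLine L e₁ dV hdV hdV0 (toHeckeCharacter L lam)
              (isUnitary_toHeckeCharacter L lam) ((isOscillatorChar_toHeckeCharacter_iff lam).mpr hlam)
              (TW (↥(maximalRealSubfield L)) a) (isSymm_TW (↥(maximalRealSubfield L)) a)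
              (isUnit_det_TW (↥(maximalRealSubfield L)) a) (JW (↥(maximalRealSubfield L)) L a)
              (JW_eq (↥(maximalRealSubfield L)) L a)) a' χ').comp
          (finAdelicCongr (↥(maximalRealSubfield L)) L (IsCMField.complexConj L) g ht hg).symm.toMonoidHom))
    (hj' : Function.Injective j') :
    Nontrivial (omegaAtLine (↥(maximalRealSubfield L)) L (IsCMField.complexConj L) 2 e₁ (Matrix.diagonal dV)
        (complexConj_imagUnit L) (imagUnit_ne_zero L) (imagUnit_mul_self L) (realDiagonal_isSymm L dV hdV)
        (isUnit_det_realDiagonal L dV hdV hdV0) (realDiagonal_map L dV hdV).symm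
        (fun a => isCompatible_chiSplittingLine L e₁ dV hdV hdV0 (toHeckeCharacter L lam)
          (isUnitary_toHeckeCharacter L lam) ((isOscillatorChar_toHeckeCharacter_iff lam).mpr hlam)
          (TW (↥(maximalRealSubfield L)) a) (isSymm_TW (↥(maximalRealSubfield L)) a)
          (isUnit_det_TW (↥(maximalRealSubfield L)) a) (JW (↥(maximalRealSubfield L)) L a)
          (JW_eq (↥(maximalRealSubfield L)) L a)) a χ) ∧
    ∃ f : omegaAtLine (↥(maximalRealSubfield L)) L (IsCMField.complexConj L) 2 e₁ (Matrix.diagonal dV)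
          (complexConj_imagUnit L) (imagUnit_ne_zero L) (imagUnit_mul_self L) (realDiagonal_isSymm L dV hdV)
          (isUnit_det_realDiagonal L dV hdV hdV0) (realDiagonal_map L dV hdV).symm
          (fun a => isCompatible_chiSplittingLine L e₁ dV hdV hdV0 (toHeckeCharacter L lam)
            (isUnitary_toHeckeCharacter L lam) ((isOscillatorChar_toHeckeCharacter_iff lam).mpr hlam)
            (TW (↥(maximalRealSubfield L)) a) (isSymm_TW (↥(maximalRealSubfield L)) a)
            (isUnit_det_TW (↥(maximalRealSubfield L)) a) (JW (↥(maximalRealSubfield L)) L a)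
            (JW_eq (↥(maximalRealSubfield L)) L a)) a χ ≃ₗ[ℂ]
        omegaAtLine (↥(maximalRealSubfield L)) L (IsCMField.complexConj L) 2 e₁ (Matrix.diagonal dV)
          (complexConj_imagUnit L) (imagUnit_ne_zero L) (imagUnit_mul_self L) (realDiagonal_isSymm L dV hdV)
          (isUnit_det_realDiagonal L dV hdV hdV0) (realDiagonal_map L dV hdV).symm
          (fun a => isCompatible_chiSplittingLine L e₁ dV hdV hdV0 (toHeckeCharacter L lam)
            (isUnitary_toHeckeCharacter L lam) ((isOscillatorChar_toHeckeCharacter_iff lam).mpr hlam)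
            (TW (↥(maximalRealSubfield L)) a) (isSymm_TW (↥(maximalRealSubfield L)) a)
            (isUnit_det_TW (↥(maximalRealSubfield L)) a) (JW (↥(maximalRealSubfield L)) L a)
            (JW_eq (↥(maximalRealSubfield L)) L a)) a' χ',
      ∀ (k : finAdelic (↥(maximalRealSubfield L)) L (IsCMField.complexConj L) 2 (Matrix.diagonal dV)) x,
        f (rhoVAtLine (↥(maximalRealSubfield L)) L (IsCMField.complexConj L) 2 e₁ (Matrix.diagonal dV)
            (complexConj_imagUnit L) (imagUnit_ne_zero L) (imagUnit_mul_self L) (realDiagonal_isSymm L dV hdV)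
            (isUnit_det_realDiagonal L dV hdV hdV0) (realDiagonal_map L dV hdV).symm
            (fun a => isCompatible_chiSplittingLine L e₁ dV hdV hdV0 (toHeckeCharacter L lam)
              (isUnitary_toHeckeCharacter L lam) ((isOscillatorChar_toHeckeCharacter_iff lam).mpr hlam)
              (TW (↥(maximalRealSubfield L)) a) (isSymm_TW (↥(maximalRealSubfield L)) a)
              (isUnit_det_TW (↥(maximalRealSubfield L)) a) (JW (↥(maximalRealSubfield L)) L a)
              (JW_eq (↥(maximalRealSubfield L)) L a)) a χ k x) =
          rhoVAtLine (↥(maximalRealSubfield L)) L (IsCMField.complexConj L) 2 e₁ (Matrix.diagonal dV)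
            (complexConj_imagUnit L) (imagUnit_ne_zero L) (imagUnit_mul_self L) (realDiagonal_isSymm L dV hdV)
            (isUnit_det_realDiagonal L dV hdV hdV0) (realDiagonal_map L dV hdV).symm
            (fun a => isCompatible_chiSplittingLine L e₁ dV hdV hdV0 (toHeckeCharacter L lam)
              (isUnitary_toHeckeCharacter L lam) ((isOscillatorChar_toHeckeCharacter_iff lam).mpr hlam)
              (TW (↥(maximalRealSubfield L)) a) (isSymm_TW (↥(maximalRealSubfield L)) a)
              (isUnit_det_TW (↥(maximalRealSubfield L)) a) (JW (↥(maximalRealSubfield L)) L a)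
              (JW_eq (↥(maximalRealSubfield L)) L a)) a' χ' k (f x) := by
  -- `2 ≤ n'` (★ `F0P5CurveThetaCompanionRelabelOfLocalFactors.two_le_of_finTwo_equiv`, inlined to keep the imports below the P5 assembler)
  have hn' : 2 ≤ n' := by
    have h := Fintype.card_congr e₁
    simp only [Fintype.card_prod, Fintype.card_fin, mul_one] at h
    omega
  -- the two transported carriers are irreducible or zero (★, rank 2), `σ` lives on a non-zero space
  haveI : Nontrivial W := by
    -- an irreducible representation has `⊥ ≠ ⊤` among its subrepresentations
    by_contra hW
    rw [not_nontrivial_iff_subsingleton] at hW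
    have hbt : (⊥ : Subrepresentation σ) = ⊤ :=
      Subrepresentation.toSubmodule_injective (Subsingleton.elim _ _)
    haveI := hirr
    exact absurd hbt bot_ne_top
  have hφ : Function.Surjective (finAdelicCongr (↥(maximalRealSubfield L)) L (IsCMField.complexConj L) g ht hg).symm.toMonoidHom :=
    fun y => ⟨(finAdelicCongr (↥(maximalRealSubfield L)) L (IsCMField.complexConj L) g ht hg) y,
      (finAdelicCongr (↥(maximalRealSubfield L)) L (IsCMField.complexConj L) g ht hg).symm_apply_apply y⟩
  have hirr0 := isIrreducibleOrZero_rhoVAtLine_chiSplittingLine_comp_of_surjective L e₁ hn' dV hdV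
    hdV0 (toHeckeCharacter L lam) (isUnitary_toHeckeCharacter L lam) ((isOscillatorChar_toHeckeCharacter_iff lam).mpr hlam) a χ
    (finAdelicCongr (↥(maximalRealSubfield L)) L (IsCMField.complexConj L) g ht hg).symm.toMonoidHom hφ
  have hirr0' := isIrreducibleOrZero_rhoVAtLine_chiSplittingLine_comp_of_surjective L e₁ hn' dV hdV
    hdV0 (toHeckeCharacter L lam) (isUnitary_toHeckeCharacter L lam) ((isOscillatorChar_toHeckeCharacter_iff lam).mpr hlam) a' χ'
    (finAdelicCongr (↥(maximalRealSubfield L)) L (IsCMField.complexConj L) g ht hg).symm.toMonoidHom hφ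
  -- (`Nonempty.elim`, not `obtain`: `rcases`'s `whnf` on these carrier types is too expensive)
  refine (nonempty_equiv_of_injective_of_isIrreducibleOrZero hirr0 j hj).elim fun E => ?_
  refine (nonempty_equiv_of_injective_of_isIrreducibleOrZero hirr0' j' hj').elim fun E' => ?_
  refine ⟨nontrivial_of_equiv E, (E.symm.trans E').toLinearEquiv, fun k x => ?_⟩
  -- `k = congr⁻¹ k₀`: the composite `E⁻¹ ≫ E′` intertwines the transported actions at `k₀`
  -- (no `rcases`/`subst`/`simp` here: `whnf` on these carrier types is too expensive; rewrite by hand)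
  have hk : (finAdelicCongr (↥(maximalRealSubfield L)) L (IsCMField.complexConj L) g ht hg).symm.toMonoidHom
      ((finAdelicCongr (↥(maximalRealSubfield L)) L (IsCMField.complexConj L) g ht hg) k) = k :=
    (finAdelicCongr (↥(maximalRealSubfield L)) L (IsCMField.complexConj L) g ht hg).symm_apply_apply k
  have h := (E.symm.trans E').toIntertwiningMap.isIntertwining _ _
    ((finAdelicCongr (↥(maximalRealSubfield L)) L (IsCMField.complexConj L) g ht hg) k) x
  rw [MonoidHom.comp_apply, MonoidHom.comp_apply, hk] at h
  rw [Representation.Equiv.toLinearEquiv_apply, Representation.Equiv.toLinearEquiv_apply]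
  exact h

end Carriers

/-! ## §3 L₂ from E₂: line-class rigidity at a fixed label from «equivalent non-zero carriers have equal collections» -/

/-- **L₂ ⇐ E₂.**  HYPOTHESIS `hE` = the print-shaped statement E₂ «at one conjugate-symplectic `λ`, an equivalence of NON-ZERO carriers
`ω(λ, ε_a, χ)_f ≃ ω(λ, ε_{a′}, χ′)_f` (as `U(diag dV)(𝔸_{L⁺,f})`-representations) forces `locF a = locF a′` pointwise» ([Liu2021, Thm. 4.18 (2)]
`ε`-component ∕ its proof «follows from Lemma D.1»; rank-2 twin of ★ `locF_eq_of_equiv_of_lemD1AsPrintedAtV`).  CONCLUSION = organ L₂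
`LineClassRigidity₂` of the LD2 cut VERBATIM: in G2's frame, an irreducible smooth `σ` with injective `j : σ → ω(λ,ε_a,χ)_f ∘ congr⁻¹` and
`j′ : σ → ω(λ,ε_{a′},χ′)_f ∘ congr⁻¹` has `locF a v = locF a′ v` at every finite place `v`.
[cite: Liu2021, Thm. 4.18 (2) p. 47 and proof p. 48 (l. 2270); App. D Lem. D.1 (1), (4) pp. 125–126; Def. 4.11, 4.12] -/
theorem lineClassRigidity₂_of_equivForces
    (hE : ∀ (L : Type) [Field L] [NumberField L] [IsCMField L]
      (dV : Fin 2 → L) (hdV : ∀ i, IsCMField.complexConj L (dV i) = dV i) (hdV0 : ∀ i, dV i ≠ 0)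
      {n' : ℕ} (e₁ : Fin 2 × Fin 1 ≃ Fin n')
      (lam : Literature.NumberTheory.Automorphic.IdeleClassGroup L →ₜ* Circle) (hlam : IsConjugateSymplectic L lam)
      (a a' : (↥(maximalRealSubfield L))ˣ) (χ χ' : Chi (↥(maximalRealSubfield L)) L (IsCMField.complexConj L)),
      Nontrivial (omegaAtLine (↥(maximalRealSubfield L)) L (IsCMField.complexConj L) 2 e₁ (Matrix.diagonal dV)
        (complexConj_imagUnit L) (imagUnit_ne_zero L) (imagUnit_mul_self L) (realDiagonal_isSymm L dV hdV)
        (isUnit_det_realDiagonal L dV hdV hdV0) (realDiagonal_map L dV hdV).symm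
        (fun a => isCompatible_chiSplittingLine L e₁ dV hdV hdV0 (toHeckeCharacter L lam)
          (isUnitary_toHeckeCharacter L lam) ((isOscillatorChar_toHeckeCharacter_iff lam).mpr hlam)
          (TW (↥(maximalRealSubfield L)) a) (isSymm_TW (↥(maximalRealSubfield L)) a)
          (isUnit_det_TW (↥(maximalRealSubfield L)) a) (JW (↥(maximalRealSubfield L)) L a)
          (JW_eq (↥(maximalRealSubfield L)) L a)) a χ) →
      (∃ f : omegaAtLine (↥(maximalRealSubfield L)) L (IsCMField.complexConj L) 2 e₁ (Matrix.diagonal dV)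
            (complexConj_imagUnit L) (imagUnit_ne_zero L) (imagUnit_mul_self L) (realDiagonal_isSymm L dV hdV)
            (isUnit_det_realDiagonal L dV hdV hdV0) (realDiagonal_map L dV hdV).symm
            (fun a => isCompatible_chiSplittingLine L e₁ dV hdV hdV0 (toHeckeCharacter L lam)
              (isUnitary_toHeckeCharacter L lam) ((isOscillatorChar_toHeckeCharacter_iff lam).mpr hlam)
              (TW (↥(maximalRealSubfield L)) a) (isSymm_TW (↥(maximalRealSubfield L)) a)
              (isUnit_det_TW (↥(maximalRealSubfield L)) a) (JW (↥(maximalRealSubfield L)) L a)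
              (JW_eq (↥(maximalRealSubfield L)) L a)) a χ ≃ₗ[ℂ]
          omegaAtLine (↥(maximalRealSubfield L)) L (IsCMField.complexConj L) 2 e₁ (Matrix.diagonal dV)
            (complexConj_imagUnit L) (imagUnit_ne_zero L) (imagUnit_mul_self L) (realDiagonal_isSymm L dV hdV)
            (isUnit_det_realDiagonal L dV hdV hdV0) (realDiagonal_map L dV hdV).symm
            (fun a => isCompatible_chiSplittingLine L e₁ dV hdV hdV0 (toHeckeCharacter L lam)
              (isUnitary_toHeckeCharacter L lam) ((isOscillatorChar_toHeckeCharacter_iff lam).mpr hlam)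
              (TW (↥(maximalRealSubfield L)) a) (isSymm_TW (↥(maximalRealSubfield L)) a)
              (isUnit_det_TW (↥(maximalRealSubfield L)) a) (JW (↥(maximalRealSubfield L)) L a)
              (JW_eq (↥(maximalRealSubfield L)) L a)) a' χ',
        ∀ (k : finAdelic (↥(maximalRealSubfield L)) L (IsCMField.complexConj L) 2 (Matrix.diagonal dV)) x,
          f (rhoVAtLine (↥(maximalRealSubfield L)) L (IsCMField.complexConj L) 2 e₁ (Matrix.diagonal dV)
              (complexConj_imagUnit L) (imagUnit_ne_zero L) (imagUnit_mul_self L) (realDiagonal_isSymm L dV hdV)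
              (isUnit_det_realDiagonal L dV hdV hdV0) (realDiagonal_map L dV hdV).symm
              (fun a => isCompatible_chiSplittingLine L e₁ dV hdV hdV0 (toHeckeCharacter L lam)
                (isUnitary_toHeckeCharacter L lam) ((isOscillatorChar_toHeckeCharacter_iff lam).mpr hlam)
                (TW (↥(maximalRealSubfield L)) a) (isSymm_TW (↥(maximalRealSubfield L)) a)
                (isUnit_det_TW (↥(maximalRealSubfield L)) a) (JW (↥(maximalRealSubfield L)) L a)
                (JW_eq (↥(maximalRealSubfield L)) L a)) a χ k x) =
            rhoVAtLine (↥(maximalRealSubfield L)) L (IsCMField.complexConj L) 2 e₁ (Matrix.diagonal dV)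
              (complexConj_imagUnit L) (imagUnit_ne_zero L) (imagUnit_mul_self L) (realDiagonal_isSymm L dV hdV)
              (isUnit_det_realDiagonal L dV hdV hdV0) (realDiagonal_map L dV hdV).symm
              (fun a => isCompatible_chiSplittingLine L e₁ dV hdV hdV0 (toHeckeCharacter L lam)
                (isUnitary_toHeckeCharacter L lam) ((isOscillatorChar_toHeckeCharacter_iff lam).mpr hlam)
                (TW (↥(maximalRealSubfield L)) a) (isSymm_TW (↥(maximalRealSubfield L)) a)
                (isUnit_det_TW (↥(maximalRealSubfield L)) a) (JW (↥(maximalRealSubfield L)) L a)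
                (JW_eq (↥(maximalRealSubfield L)) L a)) a' χ' k (f x)) →
      ∀ v : HeightOneSpectrum (𝓞 ↥(maximalRealSubfield L)),
        locF (↥(maximalRealSubfield L)) (imagUnitSq L) a v = locF (↥(maximalRealSubfield L)) (imagUnitSq L) a' v) :
  ∀ (L : Type) [Field L] [NumberField L] [IsCMField L] (ι : L →+* ℂ) (H : Matrix (Fin 2) (Fin 2) L)
        (dV : Fin 2 → L) (hdV : ∀ i, IsCMField.complexConj L (dV i) = dV i) (hdV0 : ∀ i, dV i ≠ 0)
        (t : L) (ht : t ≠ 0) (g : GL (Fin 2) L)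
        (hg : formCongr ((IsCMField.complexConj L : L ≃ₐ[↥(maximalRealSubfield L)] L) : L →+* L) g (t • H) = Matrix.diagonal dV),
        (∃ T : GL (Fin 2) ℂ, formCongr (starRingEnd ℂ) T ((Matrix.diagonal dV).map ι) = Matrix.diagonal ![(1 : ℂ), -1]) →
        (∀ τ' : L →+* ℂ, InfinitePlace.mk τ' ≠ InfinitePlace.mk ι → ((Matrix.diagonal dV).map τ').PosDef) →
        4 ≤ Module.finrank ℚ L →
        ∀ (𝔣 : ConeFrame L H (cmPlace L ι))
          (μ : Measure (adelicGroupData (↥(maximalRealSubfield L)) L (IsCMField.complexConj L) 2 H).automorphicQuotient)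
          [(adelicGroupData (↥(maximalRealSubfield L)) L (IsCMField.complexConj L) 2 H).IsAutomorphicMeasure μ]
          {n' : ℕ} (e₁ : Fin 2 × Fin 1 ≃ Fin n')
          (lam : Literature.NumberTheory.Automorphic.IdeleClassGroup L →ₜ* Circle) (hlam : IsConjugateSymplectic L lam), HasWeight L lam 1 →
        ∀ (a a' : (↥(maximalRealSubfield L))ˣ) (χ χ' : Chi (↥(maximalRealSubfield L)) L (IsCMField.complexConj L))
          (W : Type) [AddCommGroup W] [Module ℂ W]
          (σ : Representation ℂ (finAdelic (↥(maximalRealSubfield L)) L (IsCMField.complexConj L) 2 H) W),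
          σ.IsIrreducible → σ.IsSmooth →
        ∀ j : σ.IntertwiningMap
            ((rhoVAtLine (↥(maximalRealSubfield L)) L (IsCMField.complexConj L) 2 e₁ (Matrix.diagonal dV)
                (complexConj_imagUnit L) (imagUnit_ne_zero L) (imagUnit_mul_self L) (realDiagonal_isSymm L dV hdV)
                (isUnit_det_realDiagonal L dV hdV hdV0) (realDiagonal_map L dV hdV).symm
                (fun a => isCompatible_chiSplittingLine L e₁ dV hdV hdV0 (toHeckeCharacter L lam)
                  (isUnitary_toHeckeCharacter L lam) ((isOscillatorChar_toHeckeCharacter_iff lam).mpr hlam)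
                  (TW (↥(maximalRealSubfield L)) a) (isSymm_TW (↥(maximalRealSubfield L)) a)
                  (isUnit_det_TW (↥(maximalRealSubfield L)) a) (JW (↥(maximalRealSubfield L)) L a)
                  (JW_eq (↥(maximalRealSubfield L)) L a)) a χ).comp
              (finAdelicCongr (↥(maximalRealSubfield L)) L (IsCMField.complexConj L) g ht hg).symm.toMonoidHom),
          Function.Injective j →
        ∀ j' : σ.IntertwiningMap
            ((rhoVAtLine (↥(maximalRealSubfield L)) L (IsCMField.complexConj L) 2 e₁ (Matrix.diagonal dV)
                (complexConj_imagUnit L) (imagUnit_ne_zero L) (imagUnit_mul_self L) (realDiagonal_isSymm L dV hdV)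
                (isUnit_det_realDiagonal L dV hdV hdV0) (realDiagonal_map L dV hdV).symm
                (fun a => isCompatible_chiSplittingLine L e₁ dV hdV hdV0 (toHeckeCharacter L lam)
                  (isUnitary_toHeckeCharacter L lam) ((isOscillatorChar_toHeckeCharacter_iff lam).mpr hlam)
                  (TW (↥(maximalRealSubfield L)) a) (isSymm_TW (↥(maximalRealSubfield L)) a)
                  (isUnit_det_TW (↥(maximalRealSubfield L)) a) (JW (↥(maximalRealSubfield L)) L a)
                  (JW_eq (↥(maximalRealSubfield L)) L a)) a' χ').comp
              (finAdelicCongr (↥(maximalRealSubfield L)) L (IsCMField.complexConj L) g ht hg).symm.toMonoidHom),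
          Function.Injective j' →
        ∀ v : HeightOneSpectrum (𝓞 ↥(maximalRealSubfield L)),
          locF (↥(maximalRealSubfield L)) (imagUnitSq L) a v = locF (↥(maximalRealSubfield L)) (imagUnitSq L) a' v := by
  intro L _ _ _ ι H dV hdV hdV0 t ht g hg _ _ _ 𝔣 μ _ n' e₁ lam hlam _ a a' χ χ' W _ _ σ hirr _ j hj j' hj' v
  obtain ⟨hnt, hst⟩ := exists_linearEquiv_rhoVAtLine_of_injective_pair L H dV hdV hdV0 t ht g hg e₁ lam hlam a a' χ χ' σ hirr
    j hj j' hj'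
  exact hE L dV hdV hdV0 e₁ lam hlam a a' χ χ' hnt hst v

end Summit.HodgeConjecture.HodgeConjecture.Cruxes.HLiu418.F0LD2LineClassOfEquiv

end
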